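import Mathlib
import Literature.Analysis.FunctionSpaces.TorusLinearisedFormTruncation
import Literature.Analysis.FunctionSpaces.TorusFourierSeries
import Literature.Analysis.FunctionSpaces.TorusEnstrophyTrilinear
import HarnessLib

/-!
# High-mode Poincaré inequalities on the torus: the tail of the `H²` Lyapunov certificate (instab g8, cell `ns-blowup`, 2026-08-25)

HONEST FRAMING (human ruling D-0035): nothing here is a claim about Navier–Stokes blow-up.
WHAT THIS IS NOT: not NS evidence. Kernel form of the «Poincaré factors of the tail» used in the tail
inequality of THEOREM 3-L (`instab/INSTAB-BRIDGE.md` §11 l.109, §12 (L5)) and in the skew-cut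
certificates: a smooth field `w` on the unit torus with NO Fourier modes in the ball `|k|² ≤ N²`
(`Torus.fourierTruncate N w = 0`) satisfies, with `Λ_N := 4π²(N² + 1)`,
* `integral_norm_sq_le_of_truncate_eq_zero` — `Λ_N ∫‖w‖² ≤ ‖∇w‖₂²`;
* `truncate_partialDeriv_eq_zero`, `truncate_laplacian_eq_zero` — derivatives of a high-mode field
  are high-mode (truncation commutes with `∂ⱼ` and `Δ`, tree: `Torus.partialDeriv_fourierTruncate`,
  `Torus.laplacian_fourierTruncate`);
* `gradNormSq_le_of_truncate_eq_zero` — `Λ_N ‖∇w‖₂² ≤ ‖Δw‖₂²` (sum the first inequality over the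
  components `∂ⱼw` and use `∑ⱼ ‖∇∂ⱼw‖₂² = ‖Δw‖₂²`, tree: `Torus.sum_gradNormSq_partialDeriv_eq`);
* `integral_norm_laplacian_sq_le_of_truncate_eq_zero` — `Λ_N ‖Δw‖₂² ≤ ‖∇Δw‖₂²`;
so every lower-order norm of a tail field is controlled by `‖Δw‖₂` with an explicit gain `Λ_N^{-1/2}`
per derivative — the mechanism by which the `H²` tail of the linearised operator becomes dissipative
beyond an explicit mode number (`AbcH2TailConstants` for the cube-shell version's threshold).

Mathlib + Literature only; no new definitions.
-/

noncomputable section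

namespace Summit.NavierStokesRegularity.FluidComputer.HighModePoincare

open Literature.Analysis.FunctionSpaces Literature.Analysis.FunctionSpaces.Torus MeasureTheory
open scoped RealInnerProductSpace

variable {d : Type*} [Fintype d] [DecidableEq d]

/-- **High-mode Poincaré.** If the Fourier truncation of a smooth field to the ball `|k|² ≤ N²`
vanishes, then `4π²(N² + 1) ∫‖w‖² ≤ ‖∇w‖₂²`. -/
theorem integral_norm_sq_le_of_truncate_eq_zero {w : UnitAddTorus d → EuclideanSpace ℝ d}
    (hw : IsSmooth w) {N : ℕ} (h0 : fourierTruncate N w = fun _ => 0) :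
    4 * Real.pi ^ 2 * ((N : ℝ) ^ 2 + 1) * ∫ x, ‖w x‖ ^ 2 ≤ gradNormSq w := by
  have h := integral_norm_sq_fourierTruncate_sub_le_gradNormSq hw N
  have e : (fun x => ‖fourierTruncate N w x - w x‖ ^ 2) = fun x => ‖w x‖ ^ 2 := by
    funext x; rw [h0]; simp
  rw [show (∫ x, ‖fourierTruncate N w x - w x‖ ^ 2) = ∫ x, ‖w x‖ ^ 2 by rw [e]] at h
  have hpos : 0 < 4 * Real.pi ^ 2 * ((N : ℝ) ^ 2 + 1) := by positivity
  rwa [le_div_iff₀ hpos, mul_comm] at h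

/-- Derivatives of a high-mode field are high-mode: `P_N (∂ⱼ w) = ∂ⱼ (P_N w) = 0`. -/
theorem truncate_partialDeriv_eq_zero {w : UnitAddTorus d → EuclideanSpace ℝ d}
    (hw : IsSmooth w) {N : ℕ} (h0 : fourierTruncate N w = fun _ => 0) (j : d) :
    fourierTruncate N (partialDeriv j w) = fun _ => 0 := by
  funext x
  rw [← partialDeriv_fourierTruncate hw N j x, h0]
  simp [partialDeriv, Torus.lineDeriv]

/-- The Laplacian of a high-mode field is high-mode: `P_N (Δw) = Δ(P_N w) = 0`. -/
theorem truncate_laplacian_eq_zero {w : UnitAddTorus d → EuclideanSpace ℝ d}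
    (hw : IsSmooth w) {N : ℕ} (h0 : fourierTruncate N w = fun _ => 0) :
    fourierTruncate N (laplacian w) = fun _ => 0 := by
  funext x
  rw [← laplacian_fourierTruncate hw N x, h0]
  have hpd : ∀ i, partialDeriv i (fun _ : UnitAddTorus d => (0 : EuclideanSpace ℝ d))
      = fun _ => 0 := by
    intro i; funext y; simp [partialDeriv, Torus.lineDeriv]
  rw [laplacian_eq_sum_partialDeriv_partialDeriv (isSmooth_const (0 : EuclideanSpace ℝ d)) x]
  simp [hpd]

/-- **High-mode Poincaré, one derivative up.** For a high-mode smooth field,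
`4π²(N² + 1) ‖∇w‖₂² ≤ ‖Δw‖₂²`. -/
theorem gradNormSq_le_of_truncate_eq_zero {w : UnitAddTorus d → EuclideanSpace ℝ d}
    (hw : IsSmooth w) {N : ℕ} (h0 : fourierTruncate N w = fun _ => 0) :
    4 * Real.pi ^ 2 * ((N : ℝ) ^ 2 + 1) * gradNormSq w ≤ ∫ x, ‖laplacian w x‖ ^ 2 := by
  have hj : ∀ j, 4 * Real.pi ^ 2 * ((N : ℝ) ^ 2 + 1) * ∫ x, ‖partialDeriv j w x‖ ^ 2
      ≤ gradNormSq (partialDeriv j w) := fun j =>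
    integral_norm_sq_le_of_truncate_eq_zero (hw.partialDeriv j) (truncate_partialDeriv_eq_zero hw h0 j)
  have hia : ∀ j, Integrable (fun x => ‖partialDeriv j w x‖ ^ 2) volume := fun j =>
    (((hw.partialDeriv j).continuous.norm).pow 2).integrable_of_hasCompactSupport
      (HasCompactSupport.of_compactSpace _)
  have hE : gradNormSq w = ∑ j, ∫ x, ‖partialDeriv j w x‖ ^ 2 := by
    rw [gradNormSq, integral_finsetSum _ fun j _ => hia j]
  rw [hE, Finset.mul_sum, ← sum_gradNormSq_partialDeriv_eq hw]
  exact Finset.sum_le_sum fun j _ => hj j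

/-- **High-mode Poincaré, two derivatives up.** For a high-mode smooth field,
`4π²(N² + 1) ‖Δw‖₂² ≤ ‖∇Δw‖₂²`. -/
theorem integral_norm_laplacian_sq_le_of_truncate_eq_zero {w : UnitAddTorus d → EuclideanSpace ℝ d}
    (hw : IsSmooth w) {N : ℕ} (h0 : fourierTruncate N w = fun _ => 0) :
    4 * Real.pi ^ 2 * ((N : ℝ) ^ 2 + 1) * ∫ x, ‖laplacian w x‖ ^ 2 ≤ gradNormSq (laplacian w) :=
  integral_norm_sq_le_of_truncate_eq_zero hw.laplacian (truncate_laplacian_eq_zero hw h0)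

end Summit.NavierStokesRegularity.FluidComputer.HighModePoincare
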